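import Summits.BirchSwinnertonDyer.BirchSwinnertonDyer.Theorems.PrintCf2SplitBadTwoRestrictedSelmerKernelFinite
import Literature.NumberTheory.EllipticCurves.Greenberg1999.ControlLocalKernelsLayerAdditiveProofs
import HarnessLib

/-!
# Crux `PrintCf2.SplitBadTwoRankOneOfFacts` (stmt-BirchSwinnertonDyer-20368), road α v9.1 — S3c₂ piece (ii)-b (first half):
# `#W*(K*_∞) ≤ 4` — Greenberg's bound `#E(K_w^nr)[p^∞] ≤ 4` at an additive `w ∤ p`, in GLOBAL currency, on every S3c₂ frame

Cell `bsd-print-cf2`, LEAD seat `bsd-line-cf2-p1` g11 (prover-bsd-line-cf2-p1-g11-0); `--supports stmt-BirchSwinnertonDyer-20368` (helper,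
Theses-free). HONEST FRAMING: nothing here closes the crux or a registered stub; BSD is not proved by any of this; no summit statement is
proved by this seat. No definition, no named fact, no `sorry`.

p654573 (`…RestrictedSelmerKernelFinite`) proved `W*(K*_∞) := W*^{ker κ'}` FINITE on every S3c₂ frame (additive place above `7` inside the
unramified set of `K*_∞`; Silverman *ATAEC* IV.10.2(a)). This file adds the NUMBER: the tree's local theorem
`finite_and_natCard_inertiaFixed_primary_le_four_of_hasAdditiveReduction` (Greenberg LNM 1716 p. 88: `H⁰(I_v, E[p^∞]) ↪ Φ_v(k̄)`, `c_v ≤ 4`,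
Kodaira–Néron over `K_v^nr`; `Greenberg1999/ControlLocalKernelsLayerAdditiveProofs`) is stated on the minimal model over `K_w` with the
local inertia group `I_𝔐`; here it is TRANSPORTED to `E(K̄)` with the tree's global inertia currency (`absInertia K_w` through `res : Γ_{K_w} → Γ_K`
= `GreenbergSelmer.inertia w`), along the chosen embedding `K̄ → K̄_w` (`pointsMapOfEmb`, injective, equivariant) and the equivariant isomorphism
with the minimal model (`exists_addEquiv_localPoints_of_smul_eq`), exactly as in the tree's `exists_nsmul_eq_zero_of_absInertia_fixed_…`:
* `natCard_absInertia_fixed_geomPrimaryTorsion_le_four` — **`#{P ∈ E[p^∞](K̄) : I_w P = P} ≤ 4`** at an additive `w ∤ p` (any number field);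
* `natCard_fixedPoints_kerSubgroup_geomPrimaryTorsion_le_four`, `…_endEigenPrimaryTorsion_le_four` — for `κ` unramified outside `𝔮 ≠ w`:
  `#E[p^∞]^{ker κ} ≤ 4`, `#M^{ker κ} ≤ 4` for the CM summand;
* ROAD α: **`natCard_fixedPoints_kerSubgroup_of_frame_le_four`** (`#W*(K*_∞) ≤ 4` on every S3c₂ frame) and
  `padicValNat_card_ker_control_of_frame_le_two` (`v₂ #ker(𝔖_{v̄}(K, W*) → 𝔖_{v̄}(K*_∞, W*)) ≤ 2` — the KERNEL term of -w7's four-index identity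
  p652120 is bounded by the CLASS-UNIFORM constant `2`). The sharp value `W*(K*_∞) = W*[2]` (order `2`) needs `W[2] ⊆ W(K)` (`√−7 ∈ K`) — second
  half, not here.
presearch: Greenberg LNM 1716 §3 Lemma 3.3 (p. 88), Silverman AEC VII.6.1 / Cor. 6.2 — held; tree theorems only; no fact filed.

References: [GreenbergLNM1716] §3 Lemma 3.3 (PDF p. 88); [SilvermanAEC2009] Thm. VII.6.1, Cor. VII.6.2; [SilvermanATAEC1994] Cor. IV.9.2(d);
[Agboola2007] §3 Prop. 3.2.
-/

noncomputable section

open scoped Classical NNReal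

set_option linter.dupNamespace false
set_option autoImplicit false

open NumberField IsDedekindDomain Field WeierstrassCurve
open Literature.NumberTheory.EllipticCurves Literature.NumberTheory.EllipticCurves.GreenbergSelmer
open Literature.NumberTheory.EllipticCurves.Agboola2007
open Literature.NumberTheory.EllipticCurves.IwasawaDual
open Literature.NumberTheory.EllipticCurves.ResKernel
open Literature.NumberTheory.GaloisRepresentations
open IsDedekindDomain.HeightOneSpectrum

universe u

namespace Summit.BirchSwinnertonDyer.BirchSwinnertonDyer.Theorems.PrintCf2.RestrictedSelmerPair

/-! ## §1. `#{P ∈ E[p^∞](K̄) : I_w P = P} ≤ 4` at an additive place `w ∤ p`, global currency -/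

section Global

variable {K : Type u} [Field K] [NumberField K] (W : WeierstrassCurve K) [W.IsElliptic] {v : HeightOneSpectrum (𝓞 K)}

/-- **Greenberg's `#E(K_v^nr)[p^∞] ≤ 4` at an additive `v ∤ p`, read on `E(K̄)` with the global inertia currency**: the `p`-power
torsion points of `E(K̄)` fixed by the local inertia group `absInertia K_v` (acting through `absGaloisRestrict K K_v`, i.e. by
`GreenbergSelmer.inertia v`) are finite in number, at most `4`. Transport of the tree's
`finite_and_natCard_inertiaFixed_primary_le_four_of_hasAdditiveReduction` (minimal model over `K_v`, `I_𝔐 = absInertia K_v` by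
`inertia_eq_absInertia`) along `pointsMapOfEmb` and `exists_addEquiv_localPoints_of_smul_eq`.
[cite: GreenbergLNM1716, §3 Lemma 3.3 (proof, PDF p. 88)] [cite: SilvermanAEC2009, Thm. VII.6.1 and Cor. VII.6.2] -/
theorem finite_and_natCard_absInertia_fixed_geomPrimaryTorsion_le_four (p : ℕ) [Fact p.Prime]
    (hpv : ((p : ℕ) : 𝓞 K) ∉ v.asIdeal) (hadd : W.HasAdditiveReductionAt v) :
    Finite {P : W.geomPrimaryTorsion p //
        ∀ σ ∈ absInertia (v.adicCompletion K), absGaloisRestrict K (v.adicCompletion K) σ • (P : geomPoints W) = P} ∧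
      Nat.card {P : W.geomPrimaryTorsion p //
        ∀ σ ∈ absInertia (v.adicCompletion K), absGaloisRestrict K (v.adicCompletion K) σ • (P : geomPoints W) = P} ≤ 4 := by
  obtain ⟨w, hw⟩ := v.exists_spectralValuation
  obtain ⟨𝔐, h𝔐⟩ := v.localPrimesAbove_nonempty
  set X := W.localMinimalModel v with hXdef
  haveI : X.IsElliptic := W.isElliptic_localMinimalModel v
  haveI : X.HasAdditiveReduction (v.adicCompletionIntegers K) := hadd
  obtain ⟨hfinT, hcardT⟩ :=
    X.finite_and_natCard_inertiaFixed_primary_le_four_of_hasAdditiveReduction w hw h𝔐 (Fact.out : p.Prime) hpv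
  obtain ⟨C, hC⟩ := W.exists_variableChange_smul_eq_localMinimalModel v
  obtain ⟨Φ, hΦ⟩ := W.exists_addEquiv_localPoints_of_smul_eq v hC
  set ι : AlgebraicClosure K →ₐ[K] AlgebraicClosure (v.adicCompletion K) :=
    closureEmb (K := K) (v.adicCompletion K) with hι
  -- the transport map
  let f : {P : W.geomPrimaryTorsion p //
        ∀ σ ∈ absInertia (v.adicCompletion K), absGaloisRestrict K (v.adicCompletion K) σ • (P : geomPoints W) = P} →
      {P : (X.baseChange (AlgebraicClosure (v.adicCompletion K))).toAffine.Point //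
        (∀ σ ∈ 𝔐.inertia (absoluteGaloisGroup (v.adicCompletion K)),
          Affine.Point.map ((absoluteGaloisGroup.toAlgEquiv _ σ :
              AlgebraicClosure (v.adicCompletion K) ≃ₐ[v.adicCompletion K]
                AlgebraicClosure (v.adicCompletion K)) :
              AlgebraicClosure (v.adicCompletion K) →ₐ[v.adicCompletion K]
                AlgebraicClosure (v.adicCompletion K)) P = P) ∧
        ∃ k : ℕ, p ^ k • P = 0} :=
    fun P ↦ ⟨Φ (pointsMapOfEmb W ι ((P.1 : W.geomPrimaryTorsion p) : geomPoints W)), by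
      refine ⟨fun σ hσ ↦ ?_, ?_⟩
      · rw [inertia_eq_absInertia hw h𝔐] at hσ
        rw [← hΦ σ, ← pointsMapOfEmb_smul]
        congr 2
        exact P.2 σ hσ
      · obtain ⟨k, hk⟩ := (AddCommGroup.mem_primaryComponent).mp (P.1 : W.geomPrimaryTorsion p).2
        exact ⟨k, by rw [← map_nsmul, ← map_nsmul, hk, map_zero, map_zero]⟩⟩
  have hf : Function.Injective f := fun a b hab ↦ by
    have h1 := congrArg Subtype.val hab
    have h2 : pointsMapOfEmb W ι ((a.1 : W.geomPrimaryTorsion p) : geomPoints W) =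
        pointsMapOfEmb W ι ((b.1 : W.geomPrimaryTorsion p) : geomPoints W) := Φ.injective h1
    exact Subtype.ext (Subtype.ext (pointsMapOfEmb_injective W ι h2))
  haveI := hfinT
  exact ⟨Finite.of_injective f hf, (Nat.card_le_card_of_injective f hf).trans hcardT⟩

/-- **`#E[p^∞]^{ker κ} ≤ 4`** for `κ` unramified outside `𝔮` and an additive place `w ≠ 𝔮`, `w ∤ p` (`I_w ≤ ker κ`).
[cite: GreenbergLNM1716, §3 Lemma 3.3 (p. 88)] [cite: Agboola2007, §3 Prop. 3.2] -/
theorem natCard_fixedPoints_kerSubgroup_geomPrimaryTorsion_le_four {p : ℕ} [Fact p.Prime] (κ : ZpExtension K p)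
    {𝔮 : HeightOneSpectrum (𝓞 K)} (hκ : κ.IsUnramifiedOutside 𝔮) (hw : v ≠ 𝔮) (hpv : ((p : ℕ) : 𝓞 K) ∉ v.asIdeal)
    (hadd : W.HasAdditiveReductionAt v) :
    Nat.card (FixedPoints.addSubgroup κ.kerSubgroup (W.geomPrimaryTorsion p)) ≤ 4 := by
  obtain ⟨hfin, hle⟩ := finite_and_natCard_absInertia_fixed_geomPrimaryTorsion_le_four W p hpv hadd
  haveI := hfin
  let g : FixedPoints.addSubgroup κ.kerSubgroup (W.geomPrimaryTorsion p) →
      {P : W.geomPrimaryTorsion p //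
        ∀ σ ∈ absInertia (v.adicCompletion K), absGaloisRestrict K (v.adicCompletion K) σ • (P : geomPoints W) = P} :=
    fun x ↦ ⟨(x : W.geomPrimaryTorsion p), fun σ hσ ↦ by
      have h := smul_eq_self_of_mem_absInertia_of_isUnramifiedOutside κ hκ hw x.2 hσ
      have h' := congrArg (fun y : W.geomPrimaryTorsion p ↦ (y : geomPoints W)) h
      simpa only [primaryComponent.coe_smul] using h'⟩
  have hg : Function.Injective g := fun a b hab ↦ by
    have h1 := congrArg Subtype.val hab
    exact Subtype.ext h1
  exact (Nat.card_le_card_of_injective g hg).trans hle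

/-- **`#M^{ker κ} ≤ 4` for the CM summand** `M = ↥(W.endEigenPrimaryTorsion p π r)` under the same hypotheses.
[cite: GreenbergLNM1716, §3 Lemma 3.3 (p. 88)] [cite: Agboola2007, §3 Prop. 3.2] -/
theorem natCard_fixedPoints_kerSubgroup_endEigenPrimaryTorsion_le_four {p : ℕ} [Fact p.Prime] (π : W.endRing) (r : ℤ_[p])
    (κ : ZpExtension K p) {𝔮 : HeightOneSpectrum (𝓞 K)} (hκ : κ.IsUnramifiedOutside 𝔮) (hw : v ≠ 𝔮)
    (hpv : ((p : ℕ) : 𝓞 K) ∉ v.asIdeal) (hadd : W.HasAdditiveReductionAt v) :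
    Nat.card (FixedPoints.addSubgroup κ.kerSubgroup ↥(W.endEigenPrimaryTorsion p π r)) ≤ 4 := by
  haveI := finite_fixedPoints_kerSubgroup_geomPrimaryTorsion_of_hasAdditiveReductionAt W κ hκ hw hpv hadd
  let g : FixedPoints.addSubgroup κ.kerSubgroup ↥(W.endEigenPrimaryTorsion p π r) →
      FixedPoints.addSubgroup κ.kerSubgroup (W.geomPrimaryTorsion p) :=
    fun x ↦ ⟨((x : ↥(W.endEigenPrimaryTorsion p π r)) : W.geomPrimaryTorsion p), fun τ ↦ by
      have h := x.2 τ
      exact congrArg Subtype.val h⟩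
  have hg : Function.Injective g := fun a b hab ↦ by
    have h1 := congrArg Subtype.val hab
    exact Subtype.ext (Subtype.ext h1)
  exact (Nat.card_le_card_of_injective g hg).trans
    (natCard_fixedPoints_kerSubgroup_geomPrimaryTorsion_le_four W κ hκ hw hpv hadd)

end Global

/-! ## §2. Road α: `#W*(K*_∞) ≤ 4` and `v₂ #ker(control) ≤ 2` on every S3c₂ frame -/

section Frame

open Summit.BirchSwinnertonDyer.BirchSwinnertonDyer.Theorems.PrintCf2.AdditiveAtSeven

variable {K : Type} [Field K] [NumberField K]

/-- **`#W*(K*_∞) ≤ 4` on every S3c₂ frame** (member `C • W = cm7^{(d)}`, `K` imaginary quadratic, `v̄ ∣ 2`, any `π, r`, any `κ'`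
unramified outside `v̄`): the place above `7` is additive for `W_K` (p654052) and `I_{w₇} ≤ ker κ'`.
[cite: GreenbergLNM1716, §3 Lemma 3.3 (p. 88)] [cite: Agboola2007, §3 Prop. 3.2] -/
theorem natCard_fixedPoints_kerSubgroup_of_frame_le_four {d : ℤ} (hd0 : d ≠ 0) (W : WeierstrassCurve ℚ) [W.IsElliptic]
    (C : VariableChange ℚ) (hC : C • W = cm7.quadraticTwist (d : ℚ)) (hK : IsImaginaryQuadratic K)
    (vbar : HeightOneSpectrum (𝓞 K)) (hvbar : ((2 : ℕ) : 𝓞 K) ∈ vbar.asIdeal)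
    (π : (W.baseChange K).endRing) (r : ℤ_[2]) (κ' : ZpExtension K 2) (hκ' : κ'.IsUnramifiedOutside vbar) :
    Nat.card (FixedPoints.addSubgroup κ'.kerSubgroup ↥((W.baseChange K).endEigenPrimaryTorsion 2 π r)) ≤ 4 := by
  obtain ⟨w, h7⟩ := exists_heightOneSpectrum_natCast_mem (K := K) (q := 7) (by norm_num)
  have h2w : ((2 : ℕ) : 𝓞 K) ∉ w.asIdeal := natCast_two_notMem_of_seven_mem w h7
  have hw : w ≠ vbar := fun h ↦ h2w (h ▸ hvbar)
  haveI : (W.baseChange K).IsElliptic := by rw [baseChange]; infer_instance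
  exact natCard_fixedPoints_kerSubgroup_endEigenPrimaryTorsion_le_four (W.baseChange K) π r κ' hκ' hw h2w
    (hasAdditiveReductionAt_baseChange_of_j_eq_cm7_of_finrank_eq_two K w hK.1 W (j_eq_of_smul_eq_cm7Twist hd0 W C hC) h7)

/-- `#(A ⧸ N) ≤ 4` and `v₂ #A' ≤ 2` bookkeeping: a natural number `≤ 4` has `2`-adic valuation `≤ 2`. [folklore] -/
theorem padicValNat_two_le_two_of_le_four {n : ℕ} (hn : n ≤ 4) : padicValNat 2 n ≤ 2 := by
  interval_cases n
  · simp
  · simp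
  · have : padicValNat 2 2 = 1 := by simp
    omega
  · have : padicValNat 2 3 = 0 := padicValNat.eq_zero_of_not_dvd (by norm_num)
    omega
  · have : padicValNat 2 4 = 2 := by
      rw [show (4 : ℕ) = 2 ^ 2 by norm_num, padicValNat.prime_pow]
    omega

/-- **`v₂ #ker(control) ≤ 2` on every S3c₂ frame**: the kernel term of the four-index identity (p652120) is bounded by the
CLASS-UNIFORM constant `2` — `#ker ≤ #W*(K*_∞) ≤ 4` (p654573 `finite_ker_control_of_frame` + §1).
[cite: Agboola2007, §3 Prop. 3.2] [cite: GreenbergLNM1716, §3 Lemmas 3.1 and 3.3] -/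
theorem padicValNat_card_ker_control_of_frame_le_two {d : ℤ} (hd0 : d ≠ 0) (W : WeierstrassCurve ℚ) [W.IsElliptic]
    (C : VariableChange ℚ) (hC : C • W = cm7.quadraticTwist (d : ℚ)) (hK : IsImaginaryQuadratic K)
    (vbar : HeightOneSpectrum (𝓞 K)) (hvbar : ((2 : ℕ) : 𝓞 K) ∈ vbar.asIdeal)
    (π : (W.baseChange K).endRing) (r : ℤ_[2]) (κ' : ZpExtension K 2) (hκ' : κ'.IsUnramifiedOutside vbar)
    {γ' : absoluteGaloisGroup K} (hγ' : κ'.IsTopGenerator γ') :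
    Nat.card ↥(restrictedSelmerBase ↥((W.baseChange K).endEigenPrimaryTorsion 2 π r) 2 vbar ⊓
        (resOfLe ↥((W.baseChange K).endEigenPrimaryTorsion 2 π r) (le_top : κ'.kerSubgroup ≤ ⊤)).ker) ≤ 4 ∧
      padicValNat 2 (Nat.card ↥(restrictedSelmerBase ↥((W.baseChange K).endEigenPrimaryTorsion 2 π r) 2 vbar ⊓
        (resOfLe ↥((W.baseChange K).endEigenPrimaryTorsion 2 π r) (le_top : κ'.kerSubgroup ≤ ⊤)).ker)) ≤ 2 := by
  obtain ⟨-, hle⟩ := finite_ker_control_of_frame hd0 W C hC hK vbar hvbar π r κ' hκ' hγ'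
  have h4 := hle.trans (natCard_fixedPoints_kerSubgroup_of_frame_le_four hd0 W C hC hK vbar hvbar π r κ' hκ')
  exact ⟨h4, padicValNat_two_le_two_of_le_four h4⟩

end Frame

end Summit.BirchSwinnertonDyer.BirchSwinnertonDyer.Theorems.PrintCf2.RestrictedSelmerPair

end
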